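import Summits.QuantumFields.QCD.Theses.NestedDissectionSea
import Summits.QuantumFields.QCD.Theorems.RobustYangMills.Negative.NoSmallFalse

/-!
# `SeaFactorisationBridge` (crux stmt-QuantumFields-13880) — negative-side support: the first hypothesis
# `RobustYangMills` contains `SU(3)` Yang–Mills existence and mass gap

(2026-08-17: route `NestedDissectionSea` rev 25/26 dropped the item `RobustYangMills`, stmt-QuantumFields-13897,
from its file in favour of the RG-level `RobustYangMillsRG`, stmt-QuantumFields-14958, and restated the bridge
over it; the shared item 13897 itself is unchanged and still declared, verbatim, by the routes
`HeavyThresholdYMBridge` (crux 2) and `AdaptiveBlockFermions` (crux 4).  buildfix 2026-08-19: the interim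
re-point of `RobustYangMills` to the copy in the CLOSED route file `Theses/AdaptiveBlockFermions.lean` — which no
longer elaborates since the `QCDOf` re-type — is undone; `RobustYangMills` below now resolves, through
`open … NestedDissectionSea`, to the record `Summit.QuantumFields.QCD.Theses.NestedDissectionSea.RobustYangMills`
re-declared with the ledger signature verbatim in `Theorems/RobustYangMills/Negative/NoSmallFalse.lean`
(imported instead), so this module and its importer `RobustYangMills/Negative/ContainsYMUnconditional.lean`
(which spells that name) build again; statements and proofs are byte-identical.)

Standing-disprover extraction (cdisprove cycle 1).  Load-bearing analysis of the bridge's first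
hypothesis (crux 13897, shared with `HeavyThresholdYMBridge`): instantiated at `W ≡ 0` along the
canonical scaling data it yields the body of the summit conjunct `YangMills` at `G = SU(3)` — modulo ONE
explicit hypothesis, reflection positivity of Wilson's `SU(3)` measure on ODD tori `(ℤ/(2S+1))⁴` in the
format of (h2) (the tree fact `wilsonExpectation_reflectionPositive` covers even sides only).  Hence
`RobustYangMills` is not junk-true unless `YangMills` is junk-provable at `SU(3)`, and the only cheap way
the bridge can ever close is the vacuity direction through a REFUTATION of 13897, which closes the route.

* `afBeta_zero_canonical_nonneg` — `afBeta 0 1 (1/(k+1)) ≥ 0` eventually.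
* `yangMillsSU3_of_robustYangMills` — the reduction (statement inlined, no new `Prop` definitions).
-/

noncomputable section

namespace Summit.QuantumFields.QCD.Theorems.SeaFactorisationBridge.Negative

open Filter Topology
open Literature.MathematicalPhysics.QuantumFieldTheory Literature.MathematicalPhysics.QuantumLattice
open Summit.QuantumFields.QCD.Theses.NestedDissectionSea

/-- `b₀(N_f = 0) > 0`. [folklore] -/
theorem betaCoeff₀_zero_pos : 0 < betaCoeff₀ 0 := by
  unfold betaCoeff₀; norm_num; positivity

/-- `b₁(N_f = 0) ≥ 0`. [folklore] -/
theorem betaCoeff₁_zero_nonneg : 0 ≤ betaCoeff₁ 0 := by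
  unfold betaCoeff₁; norm_num; positivity

/-- Along `a_k = 1/(k+1)` the pure-gauge two-loop profile `afBeta 0 1 a_k` is eventually `≥ 0`
(both logarithms are non-negative once `(k+1)² ≥ e`). [folklore] -/
theorem afBeta_zero_canonical_nonneg : ∀ᶠ k : ℕ in atTop, 0 ≤ afBeta 0 1 (((k : ℝ) + 1)⁻¹) := by
  filter_upwards [eventually_ge_atTop 1] with k hk
  have hk' : (1 : ℝ) ≤ k := by exact_mod_cast hk
  have hx : (1 : ℝ) / ((((k : ℝ) + 1)⁻¹) ^ 2 * 1 ^ 2) = ((k : ℝ) + 1) ^ 2 := by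
    field_simp
  have h4 : Real.exp 1 ≤ ((k : ℝ) + 1) ^ 2 := by
    have := Real.exp_one_lt_d9
    nlinarith
  have hlog : 1 ≤ Real.log (((k : ℝ) + 1) ^ 2) := by
    rw [Real.le_log_iff_exp_le (by positivity)]; exact h4
  have hlog0 : 0 ≤ Real.log (((k : ℝ) + 1) ^ 2) := zero_le_one.trans hlog
  have hloglog : 0 ≤ Real.log (Real.log (((k : ℝ) + 1) ^ 2)) := Real.log_nonneg hlog
  have hb0 := betaCoeff₀_zero_pos
  have hb1 := betaCoeff₁_zero_nonneg
  unfold afBeta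
  rw [hx]
  have : 0 ≤ betaCoeff₁ 0 / betaCoeff₀ 0 := div_nonneg hb1 hb0.le
  positivity

/-- **`RobustYangMills` ⊇ Yang–Mills existence and mass gap at `SU(3)`**, modulo reflection positivity
of Wilson's measure on odd tori (hypothesis `hRP`, the odd-side companion of the tree fact
`wilsonExpectation_reflectionPositive`): instantiate the crux at `W ≡ 0` along `a_k = 1/(k+1)`,
`L_k = (k+1)²`, `β′_k = afBeta 0 1 a_k`, `Λ′ = ℓ₀ = 1` (admissibility of `0`: symmetries trivial,
`NormLE` trivial, range control vacuous, RP = `hRP` at `β′_k ≥ 0` eventually) and reindex the scheme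
along the returned subsequence `φ` (`perturbedLatticeSchwinger_zero`, `connectedCorr_zero`).  The
conclusion is the body of `YangMills` at `G = SU(3)` with the fundamental representation and the
ambient Borel structure. [folklore] -/
theorem yangMillsSU3_of_robustYangMills
    (hRP : ∀ (S b : ℕ) (β : ℝ), 0 ≤ β →
      (0 : QuasiLocalGaugePerturbation 4 (2 * S + 1) (Matrix.specialUnitaryGroup (Fin 3) ℂ) b).IsReflectionPositive (fundamentalRep (Fin 3)) β)
    (hY : RobustYangMills) :
    let r₃ : LatticeRep (Matrix.specialUnitaryGroup (Fin 3) ℂ) := ⟨3, fundamentalRep (Fin 3), continuous_fundamentalRep _,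
      fundamentalRep_injective _, fundamentalRep_mem_unitaryGroup⟩
    ∃ (sch : SpeciesScheme (YMSpecies (Matrix.specialUnitaryGroup (Fin 3) ℂ))) (T : OSData (YMSpecies (Matrix.specialUnitaryGroup (Fin 3) ℂ)) 4),
      IsYangMillsFor r₃ sch T ∧ T.IsNontrivial r₃.curvature ∧ T.IsNonGaussian r₃.curvature ∧
        ∃ Δ > 0, T.HasMassGap Δ ∧ HasLatticeMassGap r₃ sch Δ := by
  intro r₃
  obtain ⟨η₀, hη₀, κ, _hκ, h⟩ := hY
  let Z := SpeciesScheme.zero (YMSpecies (Matrix.specialUnitaryGroup (Fin 3) ℂ))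
  have hconst : Tendsto (fun k => afBeta 0 1 (Z.a k) - afBeta 0 1 (Z.a k)) atTop (𝓝 0) := by simp
  have h1 := h Z.a Z.L Z.a_pos Z.tendsto_a Z.tendsto_L (fun k => afBeta 0 1 (Z.a k)) 1 one_pos hconst 1 one_pos
    (fun k S => (0 : QuasiLocalGaugePerturbation 4 (2 * S + 1) (Matrix.specialUnitaryGroup (Fin 3) ℂ) ⌊(1 : ℝ) / Z.a k⌋₊)) ?adm
  case adm =>
    filter_upwards [afBeta_zero_canonical_nonneg] with k hk S _hS
    refine ⟨fun v U => by simp, fun U => by simp, fun π U => by simp, hRP S _ _ hk, ?_, ?_⟩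
    · exact QuasiLocalGaugePerturbation.normLE_zero
        (div_nonneg hη₀.le (zero_le_one.trans (le_max_left _ _)))
    · intro X _ hU
      obtain ⟨U, hU⟩ := hU
      simp at hU
  obtain ⟨φ, hφ, c, m, T, Δ, hΔ, hconv, hNT, hNG, hgap, hlgap, -⟩ := h1
  clear h
  let sch : SpeciesScheme (YMSpecies (Matrix.specialUnitaryGroup (Fin 3) ℂ)) :=
    { a := fun j => Z.a (φ j)
      a_pos := fun j => Z.a_pos (φ j)
      tendsto_a := Z.tendsto_a.comp hφ.tendsto_atTop
      β := fun j => afBeta 0 1 (Z.a (φ j))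
      L := fun j => Z.L (φ j)
      tendsto_L := Z.tendsto_L.comp hφ.tendsto_atTop
      c := fun s j => c s (φ j)
      m := fun s j => m s (φ j) }
  refine ⟨sch, T, ?_, hNT, hNG, Δ, hΔ, hgap, ?_⟩
  · intro n hn σ f F hF hoff
    refine (hconv n hn σ f F hF hoff).congr fun j => ?_
    simp only [perturbedLatticeSchwinger, SpeciesScheme.side, QuasiLocalGaugePerturbation.expectation_zero,
      wilsonExpectation, latticeSchwinger]
    rfl
  · intro A B
    obtain ⟨C, hC⟩ := hlgap A B
    refine ⟨C, ?_⟩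
    filter_upwards [hφ.tendsto_atTop.eventually hC] with j hj S hS n hn
    have := hj S hS n hn
    rwa [QuasiLocalGaugePerturbation.connectedCorr_zero] at this

end Summit.QuantumFields.QCD.Theorems.SeaFactorisationBridge.Negative

end
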